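import Literature.Probability.LatticeModels.KCLevelSetExit
import Literature.Probability.LatticeModels.KCSeamSectionPrimitive
import Literature.Probability.LatticeModels.LatticeHarmonicMeasure
import HarnessLib

/-!
# Lemma 3.10 of Chelkak–Hongler–Izyurov on the lattice: the values on a circle around a marked point
# are controlled by the values on an outer annulus

Topic `Literature/Probability/LatticeModels`. Chelkak–Hongler–Izyurov 2015, Lemma 3.10 (and the end of
the proof of Thm 2.16): if the (renormalised) primitive `H` were `o(M)` on compact subsets of
`Ω(ε)` while `max_{Ω(ε)} |H| = M` is attained on the discrete circle around a marked point, one gets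
a contradiction from (i) the one-sided maximum principle in the disc, (ii) a monotone lattice path
from the maximiser into the marked point (`KCLevelSetExit.lean`), (iii) the uniform comparability of
`H` on vertices and faces along the path ([CS12, Remark 3.10], `KCLocalComparability.lean`), and
(iv) the weak Beurling estimate for the harmonic measure of the path seen from a nearby point of the
annulus (`LatticeHarmonicMeasure.le_add_rpow_of_cutPath`).

This file is the ABSTRACT lattice form of that argument, for a pair of real functions `Hw` (sites),
`Hb` (plaquettes, indexed by lower-left corners) on square boxes `sqBox q R` about the marked cell,
under exactly the local hypotheses the Kadanoff–Ceva primitive satisfies there: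

* **`layer_bound_sink`** (a background spin `c`, where `Δ Hw ≤ 0` fails): `Δ Hw ≤ 0` off `c`,
  `Δ Hb ≥ 0`, `Hw ≤ Hb` cellwise, plaquette comparability; if `|Hw|, |Hb| ≤ m` on the annulus
  `sqBox c R₂ ∖ sqBox c (R₁ + t)` then `-132 m ≤ Hw, Hb ≤ m` on the layer `sqBox c R₁ ∖ sqBox c (R₁ - 1)`,
  provided `C ((t + 4)/(R₁ - 1))^β ≤ 1/2` (Beurling) and `R₂ ≥ 2 R₁`, `R₂ ≥ R₁ + t + 6`;
* **`layer_bound_source`** (the source plaquette `p₀`, where `Δ Hb ≥ 0` fails, with the exceptional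
  site `v₀ = p₀ + e₀ + e₁` for site comparability): dually `-m ≤ Hw, Hb ≤ 132 m` on the layer.

Everything is proved; no named fact.

## References

* D. Chelkak, C. Hongler, K. Izyurov, Ann. of Math. 181 (2015), Lemma 3.10 and proof of Thm 2.16
  [ChelkakHonglerIzyurovAnnals2015].
* D. Chelkak, S. Smirnov, Invent. Math. 189 (2012), Remark 3.10 [ChelkakSmirnov2012Ising].
* S. Smirnov, Ann. of Math. 172 (2010), Appendix B, Lemma B.2 [Smirnov2010].
-/

noncomputable section

namespace Literature.Probability.LatticeModels

open Finset SimpleGraph WeakBeurling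

/-! ### Box bookkeeping -/

/-- `f ∈ sqBox q (n + 1)` when a corner `f + cornerOff j` lies in `sqBox q n`. [folklore] -/
theorem mem_sqBox_of_add_cornerOff_mem {q f : Site 2} {n : ℤ} {j : Fin 4} (h : f + cornerOff j ∈ sqBox q n) :
    f ∈ sqBox q (n + 1) := by
  rw [mem_sqBox] at h ⊢
  simp only [Pi.add_apply] at h
  have h0 : cornerOff j 0 = 0 ∨ cornerOff j 0 = 1 := by fin_cases j <;> simp [cornerOff]
  have h1 : cornerOff j 1 = 0 ∨ cornerOff j 1 = 1 := by fin_cases j <;> simp [cornerOff]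
  obtain ⟨ha, hb⟩ := h
  rw [abs_le] at ha hb
  constructor
  · rw [abs_le]; rcases h0 with e | e <;> rw [e] at ha <;> constructor <;> linarith [ha.1, ha.2]
  · rw [abs_le]; rcases h1 with e | e <;> rw [e] at hb <;> constructor <;> linarith [hb.1, hb.2]

/-- The outer boundary of a box sits in the next box. [folklore] -/
theorem mem_sqBox_succ_of_mem_latticeOuterBoundary {c w : Site 2} {n : ℤ} (hw : w ∈ latticeOuterBoundary (sqBox c n)) :
    w ∈ sqBox c (n + 1) := by
  obtain ⟨-, v, hv, k, rfl⟩ := hw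
  exact mem_sqBox_succ_of_adj hv (cSrc_mem_edgeSet (v, k))

/-- Not in a smaller box. [folklore] -/
theorem not_mem_sqBox_of_not_mem {q y : Site 2} {n n' : ℤ} (h : y ∉ sqBox q n') (hn : n ≤ n') : y ∉ sqBox q n :=
  fun hy => h (sqBox_mono q hn hy)

/-- The outward shift along one coordinate. [folklore] -/
theorem exists_shift_coord {q u : Site 2} {R₁ : ℕ} (i : Fin 2) (hd : (R₁ : ℤ) ≤ |u i - q i|)
    (hu : u ∈ sqBox q R₁) (s : ℕ) :
    ∃ z : Site 2, z ∈ sqBox u s ∧ z ∉ sqBox q ((R₁ : ℤ) + s - 1) ∧ z ∈ sqBox q ((R₁ : ℤ) + s) ∧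
      ∀ v : Site 2, v ∈ sqBox q 1 → v ∉ sqBox u ((R₁ : ℤ) - 2) := by
  rw [mem_sqBox] at hu
  have hui : |u i - q i| ≤ R₁ := by fin_cases i <;> [exact hu.1; exact hu.2]
  -- the sign of `u i - q i`
  obtain ⟨σ, hσ1, hσ⟩ : ∃ σ : ℤ, (σ = 1 ∨ σ = -1) ∧ |u i - q i| = σ * (u i - q i) := by
    rcases le_or_gt 0 (u i - q i) with h | h
    · exact ⟨1, Or.inl rfl, by rw [abs_of_nonneg h, one_mul]⟩
    · exact ⟨-1, Or.inr rfl, by rw [abs_of_neg h]; ring⟩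
  set z : Site 2 := u + Pi.single i (σ * (s : ℤ)) with hzdef
  have hzi : z i = u i + σ * (s : ℤ) := by rw [hzdef]; simp
  have hzj : ∀ j, j ≠ i → z j = u j := fun j hj => by rw [hzdef]; simp [hj]
  refine ⟨z, ?_, ?_, ?_, ?_⟩
  · rw [mem_sqBox]
    have hc : ∀ j : Fin 2, |z j - u j| ≤ s := by
      intro j
      by_cases hji : j = i
      · subst hji; rw [hzi]; rcases hσ1 with rfl | rfl <;> simp
      · rw [hzj j hji]; simp
    exact ⟨hc 0, hc 1⟩
  · intro hz
    rw [mem_sqBox] at hz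
    have key : |z i - q i| ≤ (R₁ : ℤ) + s - 1 := by fin_cases i <;> [exact hz.1; exact hz.2]
    rw [hzi] at key
    have e : u i + σ * s - q i = σ * (σ * (u i - q i) + s) := by
      rcases hσ1 with rfl | rfl <;> ring
    rw [e, abs_mul, show |σ| = 1 by rcases hσ1 with rfl | rfl <;> simp, one_mul, ← hσ,
      abs_of_nonneg (by positivity)] at key
    linarith
  · rw [mem_sqBox]
    have hcoord : ∀ j : Fin 2, |z j - q j| ≤ (R₁ : ℤ) + s := by
      intro j
      by_cases hji : j = i
      · subst hji
        rw [hzi]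
        calc |u j + σ * s - q j| = |(u j - q j) + σ * s| := by ring_nf
          _ ≤ |u j - q j| + |σ * s| := abs_add_le _ _
          _ ≤ R₁ + s := by
              have : |σ * (s : ℤ)| = s := by rcases hσ1 with rfl | rfl <;> simp
              rw [this]; linarith
      · rw [hzj j hji]
        have : |u j - q j| ≤ R₁ := by fin_cases j <;> [exact hu.1; exact hu.2]
        linarith
    exact ⟨hcoord 0, hcoord 1⟩
  · intro v hv hv'
    rw [mem_sqBox] at hv hv'
    have hvi : |v i - q i| ≤ 1 := by fin_cases i <;> [exact hv.1; exact hv.2]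
    have hvu : |v i - z i + (z i - u i)| ≤ (R₁ : ℤ) - 2 := by
      have : ∀ j : Fin 2, |v j - u j| ≤ (R₁ : ℤ) - 2 := fun j => by fin_cases j <;> [exact hv'.1; exact hv'.2]
      have h := this i; rwa [show v i - u i = v i - z i + (z i - u i) by ring] at h
    rw [show v i - z i + (z i - u i) = v i - u i by ring] at hvu
    have := abs_sub_le (u i) (v i) (q i)
    rw [abs_sub_comm] at hvu
    linarith

/-- The outward shift of a layer site along its extremal coordinate. [folklore] -/
theorem exists_shift_of_layer {q u : Site 2} {R₁ : ℕ} (hu : u ∈ sqBox q R₁) (hu' : u ∉ sqBox q ((R₁ : ℤ) - 1))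
    (s : ℕ) :
    ∃ z : Site 2, z ∈ sqBox u s ∧ z ∉ sqBox q ((R₁ : ℤ) + s - 1) ∧ z ∈ sqBox q ((R₁ : ℤ) + s) ∧
      ∀ v : Site 2, v ∈ sqBox q 1 → v ∉ sqBox u ((R₁ : ℤ) - 2) := by
  have hu'' := hu'
  rw [mem_sqBox, not_and_or, not_le, not_le] at hu''
  rcases hu'' with h | h
  · exact exists_shift_coord 0 (by linarith [Int.add_one_le_iff.2 h]) hu s
  · exact exists_shift_coord 1 (by linarith [Int.add_one_le_iff.2 h]) hu s

/-! ### Near a background spin -/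

/-- **Lemma 3.10 on the lattice, near a background spin `c`.** Let `Hw` be superharmonic on
`sqBox c (R₂ - 1) ∖ {c}`, `Hb` subharmonic on `sqBox c (R₂ - 1)`, `Hw ≤ Hb` cellwise on `sqBox c R₂`,
and let the plaquette comparability of [CS12, Remark 3.10] hold on `sqBox c (R₂ - 1)`. If
`|Hw|, |Hb| ≤ m` on the annulus `sqBox c R₂ ∖ sqBox c (R₁ + t)`, then on the layer
`sqBox c R₁ ∖ sqBox c (R₁ - 1)` both functions lie in `[-132 m, m]` — provided the Beurling factor
`C ((t + 4)/(R₁ - 1))^β` is at most `1/2`. [cite: ChelkakHonglerIzyurovAnnals2015, Lemma 3.10 and proof of Thm 2.16] -/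
theorem layer_bound_sink (Hw Hb : Site 2 → ℝ) (c : Site 2) {R₁ t R₂ : ℕ} (hR₁ : 3 ≤ R₁) (h2R : 2 * R₁ ≤ R₂) (htR : R₁ + t + 6 ≤ R₂)
    {m : ℝ} (hm : 0 ≤ m)
    (hann_w : ∀ y ∈ sqBox c R₂, y ∉ sqBox c ((R₁ : ℤ) + t) → |Hw y| ≤ m)
    (hann_b : ∀ y ∈ sqBox c R₂, y ∉ sqBox c ((R₁ : ℤ) + t) → |Hb y| ≤ m)
    (hsupW : ∀ v ∈ sqBox c ((R₂ : ℤ) - 1), v ≠ c → latticeLaplacian Hw v ≤ 0)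
    (hsubB : ∀ f ∈ sqBox c ((R₂ : ℤ) - 1), 0 ≤ latticeLaplacian Hb f)
    (hWB : ∀ y ∈ sqBox c R₂, Hw y ≤ Hb y)
    (hcomp : ∀ f ∈ sqBox c ((R₂ : ℤ) - 1), ∀ m' : ℝ, (∀ j : Fin 4, Hb (f + cornerUnit (j + 3)) - Hb f ≤ m') →
      ∀ j : Fin 4, Hb f - Hw (f + cornerOff j) ≤ 32 * m')
    (hB : beurlingConst * ((((t + 3 : ℕ) : ℝ) + 1) / (((R₁ - 2 : ℕ) : ℝ) + 1)) ^ beurlingExp ≤ 1 / 2) :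
    ∀ u₀ ∈ sqBox c R₁, u₀ ∉ sqBox c ((R₁ : ℤ) - 1) →
      -(132 * m) ≤ Hw u₀ ∧ Hw u₀ ≤ m ∧ -(132 * m) ≤ Hb u₀ ∧ Hb u₀ ≤ m := by
  classical
  -- (i) `Hb ≤ m` on the whole box, by the maximum principle
  have hbM : ∀ y ∈ sqBox c R₂, Hb y ≤ m := by
    intro y hy
    by_cases hy' : y ∈ sqBox c ((R₂ : ℤ) - 1)
    · refine IsLatticeSubharmonicOn.le_of_forall_boundary_le (sqBox_finite c _) (fun f hf => hsubB f hf) (fun w hw => ?_) y hy'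
      have hw1 := mem_sqBox_succ_of_mem_latticeOuterBoundary hw
      have hw2 : w ∉ sqBox c ((R₂ : ℤ) - 1) := hw.1
      rw [sub_add_cancel] at hw1
      exact (abs_le.1 (hann_b w hw1 (not_mem_sqBox_of_not_mem hw2 (by omega)))).2
    · exact (abs_le.1 (hann_b y hy (not_mem_sqBox_of_not_mem hy' (by omega)))).2
  have hwM : ∀ y ∈ sqBox c R₂, Hw y ≤ m := fun y hy => (hWB y hy).trans (hbM y hy)
  intro u₀ hu₀ hu₀'
  have hu₀R₂ : u₀ ∈ sqBox c R₂ := sqBox_mono c (by exact_mod_cast (by omega : R₁ ≤ R₂)) hu₀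
  -- it suffices to bound `Hw u₀` from below
  suffices hlow : -(132 * m) ≤ Hw u₀ by
    exact ⟨hlow, hwM u₀ hu₀R₂, hlow.trans (hWB u₀ hu₀R₂), hbM u₀ hu₀R₂⟩
  by_contra hlt
  push Not at hlt
  set L : ℝ := -Hw u₀ with hLdef
  have hL : 132 * m < L := by rw [hLdef]; linarith
  have hLm : m < L := by linarith
  set A : ℝ := (L - 32 * m) / 33 with hA
  have hA0 : 0 < A := by rw [hA]; linarith
  have hmA : 0 < m + A := by linarith
  -- sites with `Hw ≤ -L` lie inside `sqBox c (R₁ + t)`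
  have hinner : ∀ x ∈ sqBox c R₂, Hw x ≤ -L → x ∈ sqBox c ((R₁ : ℤ) + t) := by
    intro x hx hxL
    by_contra hx'
    have := (abs_le.1 (hann_w x hx hx')).1
    linarith
  -- the level set and the plaquettes touching it
  set SL : Set (Site 2) := {x | x ∈ sqBox c ((R₁ : ℤ) + t) ∧ Hw x ≤ -L} with hSL
  set Γ : Set (Site 2) := {f | ∃ j : Fin 4, f + cornerOff j ∈ SL} with hΓ
  have hΓbox : ∀ f ∈ Γ, f ∈ sqBox c ((R₁ : ℤ) + t + 1) := by
    rintro f ⟨j, hj, -⟩; exact mem_sqBox_of_add_cornerOff_mem hj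
  have hΓA : ∀ f ∈ Γ, Hb f ≤ -A := by
    intro f hf
    obtain ⟨j, hjbox, hjL⟩ := hf
    have hf1 : f ∈ sqBox c ((R₂ : ℤ) - 1) := sqBox_mono c (by omega) (hΓbox f ⟨j, hjbox, hjL⟩)
    have key := hcomp f hf1 (m - Hb f) (fun i => ?_) j
    · rw [hA]; linarith
    · have : f + cornerUnit (i + 3) ∈ sqBox c R₂ := by
        have := add_cornerUnit_mem_sqBox hf1 (i + 3); rwa [sub_add_cancel] at this
      linarith [hbM _ this]
  -- the decreasing path from `u₀` reaches a neighbour of `c`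
  set T : Set (Site 2) := {x | x ∈ sqBox c R₂ ∧ x ≠ c} with hTdef
  have hTfin : T.Finite := (sqBox_finite c R₂).subset fun x hx => hx.1
  have hu₀c : u₀ ≠ c := by
    intro h
    apply hu₀'
    rw [h, mem_sqBox]
    constructor <;> simp <;> omega
  have hsupT : ∀ v, ReachIn {x | x ∈ T ∧ Hw x ≤ -L} u₀ v → latticeLaplacian Hw v ≤ 0 := by
    intro v hv
    have hv := hv.mem_right
    have hvin := hinner v hv.1.1 hv.2
    exact hsupW v (sqBox_mono c (by omega) hvin) hv.1.2
  obtain ⟨v, w, hR, hadj, hwT, hle⟩ := exists_exit_of_levelSet_superharmonic (H := Hw) hTfin (L := -L)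
    ⟨hu₀R₂, hu₀c⟩ (by rw [hLdef]; simp) hsupT
  have hvmem := hR.mem_right
  have hvin : v ∈ sqBox c ((R₁ : ℤ) + t) := hinner v hvmem.1.1 hvmem.2
  have hwc : w = c := by
    by_contra hne
    exact hwT ⟨sqBox_mono c (by omega) (mem_sqBox_succ_of_adj hvin hadj), hne⟩
  subst hwc
  obtain ⟨W, hW⟩ := hR
  -- the subharmonic comparison function on the plaquettes off `Γ`
  set Tb : Set (Site 2) := {f | f ∈ sqBox w ((R₂ : ℤ) - 1) ∧ f ∉ Γ} with hTb
  have hTbfin : Tb.Finite := (sqBox_finite w _).subset fun x hx => hx.1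
  set h : Site 2 → ℝ := fun f => (m + A)⁻¹ * (Hb f + A) with hh
  have hsubh : IsLatticeSubharmonicOn h Tb := by
    intro f hf
    rw [hh, latticeLaplacian_const_mul, latticeLaplacian_add_const]
    exact mul_nonneg (inv_nonneg.2 hmA.le) (hsubB f hf.1)
  have h1 : ∀ x ∈ latticeOuterBoundary Tb, h x ≤ 1 := by
    rintro x ⟨-, f, hf, k, rfl⟩
    have hx : f + cornerUnit k ∈ sqBox w R₂ := by
      have := add_cornerUnit_mem_sqBox hf.1 k; rwa [sub_add_cancel] at this
    have := hbM _ hx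
    rw [hh]; simp only
    rw [inv_mul_le_iff₀ hmA]; linarith
  have hη : ∀ x ∈ latticeOuterBoundary Tb, x ∈ sqBox u₀ ((R₁ - 2 : ℕ) : ℤ) → h x ≤ 0 := by
    rintro x ⟨hxT, f, hf, k, rfl⟩ hxu
    have hx1 : f + cornerUnit k ∈ sqBox w ((R₂ : ℤ) - 1) := by
      have h1 : f + cornerUnit k ∈ sqBox w ((R₁ : ℤ) + ((R₁ - 2 : ℕ) : ℤ)) := by
        rw [mem_sqBox] at hu₀ hxu ⊢
        constructor
        · have := abs_sub_le ((f + cornerUnit k) 0) (u₀ 0) (w 0); linarith [hxu.1, hu₀.1]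
        · have := abs_sub_le ((f + cornerUnit k) 1) (u₀ 1) (w 1); linarith [hxu.2, hu₀.2]
      exact sqBox_mono w (by omega) h1
    have hxΓ : f + cornerUnit k ∈ Γ := by
      by_contra hne; exact hxT ⟨hx1, hne⟩
    have := hΓA _ hxΓ
    rw [hh]; simp only
    rw [inv_mul_le_iff₀ hmA]; linarith
  -- the cut path: `W`, inside `SL ⊆ Γ`
  have hq : ∀ z ∈ W.support, z ∉ Tb := by
    intro z hz hzT
    have hz' := hW z hz
    have hzSL : z ∈ SL := ⟨hinner z hz'.1.1 hz'.2, hz'.2⟩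
    exact hzT.2 ⟨0, by simpa [cornerOff] using hzSL⟩
  -- the endpoint `v` (a neighbour of `c`) is far from `u₀`; the observation point `z₀`
  obtain ⟨z₀, hz₀u, hz₀out, hz₀in, hfar⟩ := exists_shift_of_layer (q := w) hu₀ hu₀' (t + 3)
  have hvbox : v ∈ sqBox w 1 := by
    have := mem_sqBox_succ_of_adj (show w ∈ sqBox w 0 by rw [mem_sqBox]; simp) hadj.symm
    simpa using this
  have hd : v ∉ sqBox u₀ ((R₁ - 2 : ℕ) : ℤ) := by
    have := hfar v hvbox
    rwa [Nat.cast_sub (by omega)]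
  have hz₀R : z₀ ∈ sqBox w ((R₂ : ℤ) - 1) := sqBox_mono w (by push_cast; omega) hz₀in
  have hz₀Γ : z₀ ∉ Γ := fun hz => hz₀out (sqBox_mono w (by push_cast; omega) (hΓbox z₀ hz))
  have hz₀T : z₀ ∈ Tb := ⟨hz₀R, hz₀Γ⟩
  have hz₀ann : -m ≤ Hb z₀ := by
    have h1 : z₀ ∈ sqBox w R₂ := sqBox_mono w (by push_cast; omega) hz₀in
    have h2 : z₀ ∉ sqBox w ((R₁ : ℤ) + t) := not_mem_sqBox_of_not_mem hz₀out (by push_cast; omega)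
    exact (abs_le.1 (hann_b z₀ h1 h2)).1
  have hz₀ρ : z₀ ∈ sqBox u₀ ((t + 3 : ℕ) : ℤ) := by push_cast; exact hz₀u
  -- Beurling
  have key := le_add_rpow_of_cutPath hTbfin hsubh h1 (p := u₀) (R := R₁ - 2) (η := 0) le_rfl hη W hd hq hz₀T hz₀ρ
  rw [zero_add] at key
  have hhalf : h z₀ ≤ 1 / 2 := key.trans hB
  rw [hh] at hhalf; simp only at hhalf
  rw [inv_mul_le_iff₀ hmA] at hhalf
  -- `-m + A ≤ (m + A)/2` gives `A ≤ 3 m`, i.e. `L ≤ 131 m`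
  have : A ≤ 3 * m := by linarith
  rw [hA] at this
  linarith

/-! ### Near the source plaquette -/

/-- Translation of `ℤ²` as a graph homomorphism. [folklore] -/
def translateHom (d : Site 2) : zdGraph 2 →g zdGraph 2 where
  toFun x := x + d
  map_rel' {x y} h := by
    obtain ⟨k, rfl⟩ := exists_eq_add_cornerUnit_of_adj h
    rw [add_right_comm]
    exact cSrc_mem_edgeSet (x + d, k)

/-- Translating both the point and the centre does not change box membership. [folklore] -/
theorem add_mem_sqBox_add_iff {u g d : Site 2} {n : ℤ} : g + d ∈ sqBox (u + d) n ↔ g ∈ sqBox u n := by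
  simp only [mem_sqBox, Pi.add_apply, add_sub_add_right_eq_sub]

/-- Shifting the centre by a corner offset costs one unit of radius. [folklore] -/
theorem sqBox_subset_sqBox_add_cornerOff (u : Site 2) (j : Fin 4) (n : ℤ) : sqBox u n ⊆ sqBox (u + cornerOff j) (n + 1) := by
  intro z hz
  rw [mem_sqBox] at hz ⊢
  have h0 : cornerOff j 0 = 0 ∨ cornerOff j 0 = 1 := by fin_cases j <;> simp [cornerOff]
  have h1 : cornerOff j 1 = 0 ∨ cornerOff j 1 = 1 := by fin_cases j <;> simp [cornerOff]
  obtain ⟨ha, hb⟩ := hz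
  rw [abs_le] at ha hb
  simp only [Pi.add_apply]
  constructor
  · rw [abs_le]; rcases h0 with e | e <;> rw [e] <;> constructor <;> linarith [ha.1, ha.2]
  · rw [abs_le]; rcases h1 with e | e <;> rw [e] <;> constructor <;> linarith [hb.1, hb.2]

/-- **Lemma 3.10 on the lattice, near the source plaquette `p₀`.** Let `Hw` be superharmonic on
`sqBox p₀ (R₂ - 1)` (no exception), `Hb` subharmonic on `sqBox p₀ (R₂ - 1) ∖ {p₀}`, `Hw ≤ Hb` cellwise
on `sqBox p₀ R₂`, and let the site comparability of [CS12, Remark 3.10] hold on `sqBox p₀ (R₂ - 1)`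
off the source site `v₀ = p₀ + e₀ + e₁`. If `|Hw|, |Hb| ≤ m` on the annulus
`sqBox p₀ R₂ ∖ sqBox p₀ (R₁ + t)`, then on the layer `sqBox p₀ R₁ ∖ sqBox p₀ (R₁ - 1)` both functions
lie in `[-m, 132 m]`, provided `C ((t + 6)/(R₁ - 1))^β ≤ 1/2`. [cite: ChelkakHonglerIzyurovAnnals2015, Lemma 3.10 and proof of Thm 2.16] -/
theorem layer_bound_source (Hw Hb : Site 2 → ℝ) (p₀ : Site 2) {R₁ t R₂ : ℕ} (hR₁ : 3 ≤ R₁) (h2R : 2 * R₁ + 2 ≤ R₂)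
    (htR : R₁ + t + 8 ≤ R₂) {m : ℝ} (hm : 0 ≤ m)
    (hann_w : ∀ y ∈ sqBox p₀ R₂, y ∉ sqBox p₀ ((R₁ : ℤ) + t) → |Hw y| ≤ m)
    (hann_b : ∀ y ∈ sqBox p₀ R₂, y ∉ sqBox p₀ ((R₁ : ℤ) + t) → |Hb y| ≤ m)
    (hsupW : ∀ v ∈ sqBox p₀ ((R₂ : ℤ) - 1), latticeLaplacian Hw v ≤ 0)
    (hsubB : ∀ f ∈ sqBox p₀ ((R₂ : ℤ) - 1), f ≠ p₀ → 0 ≤ latticeLaplacian Hb f)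
    (hWB : ∀ y ∈ sqBox p₀ R₂, Hw y ≤ Hb y)
    (hcomp : ∀ u ∈ sqBox p₀ ((R₂ : ℤ) - 1), u ≠ p₀ + cornerUnit 0 + cornerUnit 1 → ∀ m' : ℝ,
      (∀ k : Fin 4, Hw u - Hw (u + cornerUnit k) ≤ m') → ∀ k : Fin 4, Hb (faceAt u k) - Hw u ≤ 32 * m')
    (hB : beurlingConst * ((((t + 5 : ℕ) : ℝ) + 1) / (((R₁ - 2 : ℕ) : ℝ) + 1)) ^ beurlingExp ≤ 1 / 2) :
    ∀ f₀ ∈ sqBox p₀ R₁, f₀ ∉ sqBox p₀ ((R₁ : ℤ) - 1) →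
      -m ≤ Hw f₀ ∧ Hw f₀ ≤ 132 * m ∧ -m ≤ Hb f₀ ∧ Hb f₀ ≤ 132 * m := by
  classical
  -- (i) `-m ≤ Hw` on the whole box, by the minimum principle
  have hwm : ∀ y ∈ sqBox p₀ R₂, -m ≤ Hw y := by
    intro y hy
    by_cases hy' : y ∈ sqBox p₀ ((R₂ : ℤ) - 1)
    · refine IsLatticeSuperharmonicOn.ge_of_forall_boundary_ge (sqBox_finite p₀ _) (fun v hv => hsupW v hv) (fun w hw => ?_) y hy'
      have hw1 := mem_sqBox_succ_of_mem_latticeOuterBoundary hw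
      have hw2 : w ∉ sqBox p₀ ((R₂ : ℤ) - 1) := hw.1
      rw [sub_add_cancel] at hw1
      exact (abs_le.1 (hann_w w hw1 (not_mem_sqBox_of_not_mem hw2 (by omega)))).1
    · exact (abs_le.1 (hann_w y hy (not_mem_sqBox_of_not_mem hy' (by omega)))).1
  have hbm : ∀ y ∈ sqBox p₀ R₂, -m ≤ Hb y := fun y hy => (hwm y hy).trans (hWB y hy)
  intro f₀ hf₀ hf₀'
  have hf₀R₂ : f₀ ∈ sqBox p₀ R₂ := sqBox_mono p₀ (by exact_mod_cast (by omega : R₁ ≤ R₂)) hf₀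
  suffices hup : Hb f₀ ≤ 132 * m by
    exact ⟨hwm f₀ hf₀R₂, (hWB f₀ hf₀R₂).trans hup, hbm f₀ hf₀R₂, hup⟩
  by_contra hlt
  push Not at hlt
  set L : ℝ := Hb f₀ with hLdef
  have hLm : m < L := by linarith
  set A : ℝ := (L - 32 * m) / 33 with hA
  have hA0 : 0 < A := by rw [hA]; linarith
  have hmA : 0 < m + A := by linarith
  -- plaquettes with `L ≤ Hb` lie inside `sqBox p₀ (R₁ + t)`
  have hinner : ∀ x ∈ sqBox p₀ R₂, L ≤ Hb x → x ∈ sqBox p₀ ((R₁ : ℤ) + t) := by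
    intro x hx hxL
    by_contra hx'
    have := (abs_le.1 (hann_b x hx hx')).2
    linarith
  set v₀ : Site 2 := p₀ + cornerUnit 0 + cornerUnit 1 with hv₀
  set SL : Set (Site 2) := {f | f ∈ sqBox p₀ ((R₁ : ℤ) + t) ∧ L ≤ Hb f} with hSL
  set Γ : Set (Site 2) := {u | u ≠ v₀ ∧ ∃ k : Fin 4, faceAt u k ∈ SL} with hΓ
  have hΓbox : ∀ u ∈ Γ, u ∈ sqBox p₀ ((R₁ : ℤ) + t + 1) := by
    rintro u ⟨-, k, hk, -⟩; exact mem_sqBox_of_faceAt_mem hk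
  have hΓA : ∀ u ∈ Γ, A ≤ Hw u := by
    rintro u ⟨huv, k, hkbox, hkL⟩
    have hu1 : u ∈ sqBox p₀ ((R₂ : ℤ) - 1) := sqBox_mono p₀ (by omega) (hΓbox u ⟨huv, k, hkbox, hkL⟩)
    have key := hcomp u hu1 huv (Hw u + m) (fun i => ?_) k
    · rw [hA]; linarith
    · have : u + cornerUnit i ∈ sqBox p₀ R₂ := by
        have := add_cornerUnit_mem_sqBox hu1 i; rwa [sub_add_cancel] at this
      linarith [hwm _ this]
  -- the increasing path of plaquettes from `f₀` reaches a neighbour of `p₀`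
  set T : Set (Site 2) := {x | x ∈ sqBox p₀ R₂ ∧ x ≠ p₀} with hTdef
  have hTfin : T.Finite := (sqBox_finite p₀ R₂).subset fun x hx => hx.1
  have hf₀p : f₀ ≠ p₀ := by
    intro h
    apply hf₀'
    rw [h, mem_sqBox]
    constructor <;> simp <;> omega
  have hsubT : ∀ g, ReachIn {x | x ∈ T ∧ L ≤ Hb x} f₀ g → 0 ≤ latticeLaplacian Hb g := by
    intro g hg
    have hg := hg.mem_right
    have hgin := hinner g hg.1.1 hg.2
    exact hsubB g (sqBox_mono p₀ (by omega) hgin) hg.1.2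
  obtain ⟨g, w, hR, hadj, hwT, hle⟩ := exists_exit_of_levelSet_subharmonic (H := Hb) hTfin (L := L)
    ⟨hf₀R₂, hf₀p⟩ (by rw [hLdef]) hsubT
  have hgmem := hR.mem_right
  have hgin : g ∈ sqBox p₀ ((R₁ : ℤ) + t) := hinner g hgmem.1.1 hgmem.2
  have hwp : w = p₀ := by
    by_contra hne
    exact hwT ⟨sqBox_mono p₀ (by omega) (mem_sqBox_succ_of_adj hgin hadj), hne⟩
  subst hwp
  obtain ⟨W, hW⟩ := hR
  -- the site walk: translate by `cornerOff 2` (upper-right corners; it avoids `v₀` since `p₀ ∉ T`)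
  set W' := W.map (translateHom (cornerOff 2)) with hW'
  -- the comparison function on the sites off `Γ`
  set Tw : Set (Site 2) := {u | u ∈ sqBox w ((R₂ : ℤ) - 1) ∧ u ∉ Γ} with hTw
  have hTwfin : Tw.Finite := (sqBox_finite w _).subset fun x hx => hx.1
  set h : Site 2 → ℝ := fun u => (m + A)⁻¹ * ((-Hw) u + A) with hh
  have hsubh : IsLatticeSubharmonicOn h Tw := by
    intro u hu
    rw [hh, latticeLaplacian_const_mul, latticeLaplacian_add_const, latticeLaplacian_neg]
    exact mul_nonneg (inv_nonneg.2 hmA.le) (by linarith [hsupW u hu.1])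
  have h1 : ∀ x ∈ latticeOuterBoundary Tw, h x ≤ 1 := by
    rintro x ⟨-, u, hu, k, rfl⟩
    have hx : u + cornerUnit k ∈ sqBox w R₂ := by
      have := add_cornerUnit_mem_sqBox hu.1 k; rwa [sub_add_cancel] at this
    have := hwm _ hx
    rw [hh]; simp only [Pi.neg_apply]
    rw [inv_mul_le_iff₀ hmA]; linarith
  have hη : ∀ x ∈ latticeOuterBoundary Tw, x ∈ sqBox (f₀ + cornerOff 2) ((R₁ - 2 : ℕ) : ℤ) → h x ≤ 0 := by
    rintro x ⟨hxT, u, hu, k, rfl⟩ hxu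
    have hx1 : u + cornerUnit k ∈ sqBox w ((R₂ : ℤ) - 1) := by
      have hc : f₀ + cornerOff 2 ∈ sqBox w ((R₁ : ℤ) + 1) := add_cornerOff_mem_sqBox hf₀ 2
      have h1 : u + cornerUnit k ∈ sqBox w ((R₁ : ℤ) + 1 + ((R₁ - 2 : ℕ) : ℤ)) := by
        rw [mem_sqBox] at hc hxu ⊢
        constructor
        · have := abs_sub_le ((u + cornerUnit k) 0) ((f₀ + cornerOff 2) 0) (w 0); linarith [hxu.1, hc.1]
        · have := abs_sub_le ((u + cornerUnit k) 1) ((f₀ + cornerOff 2) 1) (w 1); linarith [hxu.2, hc.2]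
      exact sqBox_mono w (by omega) h1
    have hxΓ : u + cornerUnit k ∈ Γ := by
      by_contra hne; exact hxT ⟨hx1, hne⟩
    have := hΓA _ hxΓ
    rw [hh]; simp only [Pi.neg_apply]
    rw [inv_mul_le_iff₀ hmA]; linarith
  -- the cut path `W'` lies in `Γ`
  have hq : ∀ z ∈ W'.support, z ∉ Tw := by
    intro z hz hzT
    rw [hW', Walk.support_map, List.mem_map] at hz
    obtain ⟨f, hf, rfl⟩ := hz
    have hf' := hW f hf
    have hfSL : f ∈ SL := ⟨hinner f hf'.1.1 hf'.2, hf'.2⟩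
    apply hzT.2
    refine ⟨fun heq => hf'.1.2 ?_, 2, ?_⟩
    · -- `f + cornerOff 2 = v₀ = p₀ + cornerOff 2` forces `f = p₀`
      have h2 : (translateHom (cornerOff 2)) f = f + cornerOff 2 := rfl
      have : f + cornerOff 2 = w + cornerOff 2 := by
        rw [← h2, heq, hv₀, add_assoc]; congr 1
      exact add_right_cancel this
    · show faceAt (f + cornerOff 2) 2 ∈ SL
      rw [faceAt_add_cornerOff]; exact hfSL
  -- the endpoint is far, the observation site `z₀`
  obtain ⟨z₀, hz₀u, hz₀out, hz₀in, hfar⟩ := exists_shift_of_layer (q := w) hf₀ hf₀' (t + 4)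
  have hgbox : g ∈ sqBox w 1 := by
    have := mem_sqBox_succ_of_adj (show w ∈ sqBox w 0 by rw [mem_sqBox]; simp) hadj.symm
    simpa using this
  have hd : (translateHom (cornerOff 2)) g ∉ sqBox (f₀ + cornerOff 2) ((R₁ - 2 : ℕ) : ℤ) := by
    show g + cornerOff 2 ∉ sqBox (f₀ + cornerOff 2) ((R₁ - 2 : ℕ) : ℤ)
    rw [add_mem_sqBox_add_iff]
    have := hfar g hgbox
    rwa [Nat.cast_sub (by omega)]
  have hz₀R : z₀ ∈ sqBox w ((R₂ : ℤ) - 1) := sqBox_mono w (by push_cast; omega) hz₀in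
  have hz₀Γ : z₀ ∉ Γ := fun hz => hz₀out (sqBox_mono w (by push_cast; omega) (hΓbox z₀ hz))
  have hz₀T : z₀ ∈ Tw := ⟨hz₀R, hz₀Γ⟩
  have hz₀ann : Hw z₀ ≤ m := by
    have h1 : z₀ ∈ sqBox w R₂ := sqBox_mono w (by push_cast; omega) hz₀in
    have h2 : z₀ ∉ sqBox w ((R₁ : ℤ) + t) := not_mem_sqBox_of_not_mem hz₀out (by push_cast; omega)
    exact (abs_le.1 (hann_w z₀ h1 h2)).2
  have hz₀ρ : z₀ ∈ sqBox (f₀ + cornerOff 2) ((t + 5 : ℕ) : ℤ) := by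
    have := sqBox_subset_sqBox_add_cornerOff f₀ 2 _ hz₀u
    push_cast at this ⊢
    convert this using 2; ring
  -- Beurling
  have key := le_add_rpow_of_cutPath hTwfin hsubh h1 (p := f₀ + cornerOff 2) (R := R₁ - 2) (η := 0) le_rfl hη W' hd hq hz₀T hz₀ρ
  rw [zero_add] at key
  have hhalf : h z₀ ≤ 1 / 2 := key.trans hB
  rw [hh] at hhalf; simp only [Pi.neg_apply] at hhalf
  rw [inv_mul_le_iff₀ hmA] at hhalf
  have : A ≤ 3 * m := by linarith
  rw [hA] at this
  linarith

end Literature.Probability.LatticeModels
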